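import Mathlib
import Literature.MathematicalPhysics.QuantumFieldTheory.Balaban1983to89.B9H163

/-! # `Balaban1983to89.B9Eq3184` — B9 Sect. E pp. 431–432, (3.176)–(3.182) and (3.184): the substitution algebra
# behind (3.183), kernel-checked; the sign of (3.182) corrected and the printed sign refuted

CITATION HEADER.  Unit `b2b-balaban-b09` (gen 14, cell pub-balaban), PAPER SUB-CELL B09 =
T. Balaban, *Propagators for lattice gauge theories in a background field*, Commun. Math. Phys. **99** (1985) 389–434
[`Balaban1985BackgroundPropagators`] (= B9).  Sect. E, pp. 431–432 [PDF 43–44] (renders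
`1985-cmp99-background-propagators-p043-x2.png`, `…-p044-x2.png`, READ AS IMAGES — the Euclid text layer is
unreliable), verbatim:
*"The equality (3.173) gives 𝒢̃ = 𝒢 + H′C′^{(k)}(Λ)H′*, (3.175) hence by (3.172) G̃′R̃ = G′R + H′C′^{(k)}(Λ)H′*Δ. (3.176)
Let us notice that by (3.163) we have ΔH′μ = G′Q′*(Q′G′²Q′*)^{−1}(μ − aQ′G′Q′*μ), (3.177) hence ΔH′μ is a regular
function … Using the Landau gauge condition R̃D*A = 0 in (3.170), and the identity (3.176), we can write
DG′RD*A = −DH′C′^{(k)}(Λ)H′*ΔD*A. (3.178)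
Now we make the same transformation as in (3.121).  We get the integral (3.170) with the exponential gauge fixing
density instead of the δ-function, and with A replaced by A − DG̃′R̃D*A in the remaining expressions.  Let us calculate
how this replacement changes the expressions.  We have
H′*ΔD*(A − DG̃′R̃D*A) = H′*ΔD*A − H′*Δ²𝒢̃ΔD*A = H′*ΔD*A − H′*ΔR̃D*A = H′*ΔP̃D*A, (3.179)
μ(Q(A − DG̃′R̃D*A)) = μ(QA) − μ(D̄Q′G̃′R̃D*A), (3.180)
but μ(D̄v) = −v if Q′₁v = 0, as it follows from the formula (3.169).  Also we have v = Q′G̃′R̃D*A = 0 outside Λ,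
Q′₁v = 0 on Λ′, hence
μ(Q(A − DG̃′R̃D*A)) = μ(QA) + Q′G̃′R̃D*A. (3.181)
Finally we have quite generally
Q(A − Dλ) + D̄μ(Q(A − Dλ)) = QA − D̄Q′λ + D̄μ(QA) − D̄μ(D̄Q′λ) = QA − D̄μ(QA), if Q̃′λ = 0. (3.182)
These identities give
exp(½⟨g, C^{(k)}(Λ)g⟩) = Z̃^{−1}∫dA δ(Q̃A) exp[−½‖R̃D*A‖² + ⟨H₁D̃^{(2)}(QA + D̄μ(QA)), J⟩
  − ½⟨A − DG̃′R̃D*A + Dλ̃(A), (Δ + Δ^{(2)})(A − DG̃′R̃D*A + Dλ̃(A))⟩ + ⟨QA + D̄μ(QA), g⟩], (3.183)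
where λ̃(A) = H′C′^{(k)}(Λ)H′*ΔP̃D*A + H′μ(QA) + H′Q′G̃′R̃D*A. (3.184)"*
Earlier printed identities used as NAMED HYPOTHESES OF PRINTED SHAPE (each kernel-certified elsewhere in this package,
BY NAME, or a definition): p. 394 (3.23) *"Δ^η_U = D^{η*}_U D^η_U"* (the covariant Laplace operator on site functions:
`Dᵀ * D = Δ` below — the reading of `Δ` in (3.176)–(3.184) forced by p. 419 (3.118) *"RD*(A − Dλ) = RD*A − RΔλ =
RD*A − Δλ"*, cf. GAPS C-adv4-55); p. 418 (3.115) *"Q_jDλ = D^{L^jη}_{Ū^j}Q′_jλ = D̄^jQ′_jλ"* (here `Q D = D̄ Q′`);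
p. 430 (3.172) *"G′R = 𝒢Δ, G̃′R̃ = 𝒢̃Δ"* ([b09 g13's] `B9SectECov.eq_3172`, for the unwavy and the wavy data);
p. 426 L2–3 / [B6] (2.26) *"R = Δ𝒢Δ"* ([g13's] `B9SectECov.R_eq_226`); (3.175) ([g13's] `B9SectECov.eq_3175`,
`eq_3175_symm`); the consequence `Q̃′G̃′R̃ = 0` of p. 394 (3.25) *"Rf = (I − G′Q′*(Q′G′²Q′*)^{−1}Q′G′)f"* for the wavy
data (`Q_mul_G'_mul_R`, `wavy_kills` below, from [adv1's] `B9H163.G'`, `B9H163.R`); `P̃ = I − R̃` (the complementary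
projection — the reading under which (3.179) holds, as in C-adv4-55 / C-adv8-2); and the (3.169) rule
*"μ(D̄v) = −v if Q′₁v = 0"*
(derived below from uniqueness, `mu_Dbar_of_unique`; the concrete `μ(B)` of (3.169) is [b09 g12's] `B9Eq3169Mu.mu`
with `mu_unique'`).

THE POINT.  The passage from (3.170) to (3.183) is (α) a Faddeev–Popov change of the gauge-fixing δ-function into an
exponential density *"as in (3.121)"* — a measure-level step, NOT typed here (located; the finite-dimensional tools are
[this lineage's] `B9Eq3166.eq_3160`/`eq_3166`) — followed by (β) a purely ALGEBRAIC substitution `A ↦ A − DG̃′R̃D*A`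
in the two A-dependent expressions of (3.170): the configuration `A − DG′RD*A + DH′μ(QA)` of the quadratic form
(rewritten first, ON THE LANDAU SURFACE `R̃D*A = 0`, as `A + DH′C′H′*ΔD*A + DH′μ(QA)` by (3.178)) and the source
field `QA + D̄μ(QA)`.  Part (β) is what (3.176)–(3.182), (3.184) compute, and it is kernel-checked here over real
matrices of arbitrary finite index types: fine sites `n`, fine bonds `b`, Λ′-level sites `m` (where `μ` lives),
first-level bonds `b₁` (where `B = QA` lives), next-level sites `m₁` (the range of `Q′₁`).

WHAT THIS FILE CERTIFIES (kernel; `D : Matrix b n ℝ` is the derivative *sites → bonds*, so `D* = Dᵀ`;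
`Q : Matrix b₁ b ℝ` the bond averaging, `Qp = Q′`, `Qp1 = Q′₁`, `Db = D̄`, `Gw, Rw, cGw = G̃′, R̃, 𝒢̃`,
`Gp, Rp, cG = G′, R, 𝒢`, `Hp = H′`, `Cp = C′^{(k)}(Λ)`, `μ` an ℝ-linear map `(b₁ → ℝ) →ₗ[ℝ] (m → ℝ)`):
1. `eq_3176` — (3.176) from (3.172) (both sequences) and (3.175): one line of algebra, as printed.
2. `eq_3177` — (3.177) `ΔH′μ = G′Q′*(Q′G′²Q′*)⁻¹(μ − aQ′G′Q′*μ)` for [adv1's] `B9H163.H163` (the operator of (3.163)),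
   BY NAME from `B9H163.Δ_mul_H163` (an edge to the Sect. E translation operator `H′`).
3. `eq_3178_vec`, `eq_3178` — (3.178): on the Landau surface `R̃D*A = 0`, (3.176) applied to `D*A` gives
   `G′RD*A = −H′C′H′*ΔD*A`, hence `DG′RD*A = −DH′C′H′*ΔD*A`; `cfg170_eq_cfg178` — the configuration of (3.170) equals
   `A + DH′C′H′*ΔD*A + DH′μ(QA)` there.
4. `eq_3179` — (3.179), all three printed links, from `D*D = Δ`, `G̃′R̃ = 𝒢̃Δ`, `Δ𝒢̃Δ = R̃`, `P̃ = 1 − R̃`.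
5. `mu_Dbar_of_unique` — the rule *"μ(D̄v) = −v if Q′₁v = 0, as it follows from the formula (3.169)"*: for ANY
   selector `mu` of the constraints `Q′₁μ = 0 ∧ χ(B + D̄μ) = 0` (χ = restriction to the axial bonds) that are uniquely
   solvable, `mu(D̄v) = −v` whenever `Q′₁v = 0` (because `−v` solves them at `B = D̄v`).
6. `eq_3180`, `eq_3181` — (3.180) from `QD = D̄Q′` and linearity of `μ`; (3.181) from the rule and `Q′₁Q′G̃′R̃ = 0`
   (hypothesis `hv`; for the paper's wavy data `G̃′ = G′(Δ, Q̃′, a)`, `R̃ = R(Δ, Q̃′, a)` with `Q̃′ = Q′₁Q′` it is the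
   theorem `wavy_kills`, from (3.25) `Q_mul_G'_mul_R`).
7. `eq_3182` — (3.182) WITH THE CORRECTED SIGN `Q(A − Dλ) + D̄μ(Q(A − Dλ)) = QA + D̄μ(QA)` if `Q̃′λ = 0`
   (`Q′₁Q′λ = 0`); `eq_3182_printed_fails` — the printed right-hand side `QA − D̄μ(QA)` is FALSE under the same
   hypotheses (kernel counterexample: all operators `1×1`, `Q = D = D̄ = Q′ = 1`, `Q′₁ = 0`, `μ = −id`, `A = 1`, `λ = 0`,
   where the left side is `0` and the printed right side is `2`).  The corrected sign is the one (3.183) actually uses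
   (`⟨QA + D̄μ(QA), g⟩`, `H₁D̃^{(2)}(QA + D̄μ(QA))`) — GAPS G-adv8-2 (ii) and C-adv4-55, now kernel.
8. `lamT` = λ̃(A) of (3.184) (definition, printed shape); `config_3183` — substituting `A′ = A − DG̃′R̃D*A` into
   `A + DH′C′H′*ΔD*A + DH′μ(QA)` gives EXACTLY `A − DG̃′R̃D*A + Dλ̃(A)`, the configuration inside (3.183);
   `source_3183` — the source field is unchanged: `QA′ + D̄μ(QA′) = QA + D̄μ(QA)` (= (3.182) with `λ = G̃′R̃D*A`,
   `Q̃′λ = 0` by `hv`), the field inside `⟨·, g⟩` and `H₁D̃^{(2)}(·)` of (3.183).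
WHAT IT DOES NOT CERTIFY: the measure-level Faddeev–Popov step *"the same transformation as in (3.121)"* and the
constants `Z̃` (located only; C-B9-57 residual (i) keeps this part BY HAND: C-adv4-55, C-adv8-2, G-adv8-1, G-adv4-33);
the regularity claims after (3.177) (*"DΔH′μ is bounded, and even Hölder norms are bounded"*) and the G₂-analysis of
p. 432 (G-B9-10); the identities (3.172), (3.175), `R̃ = Δ𝒢̃Δ`, `QD = D̄Q′`, `D*D = Δ` themselves (hypotheses of printed
shape here; kernel elsewhere as cited above).
MODELLING / DIVERGENCE (recorded as D-b09.50): (a) ONE abstract lattice: the print's dichotomy *"v = 0 outside Λ,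
Q′₁v = 0 on Λ′"* is encoded in the single matrix hypothesis `hv : Q′₁·Q′·G̃′·R̃ = 0` (outside Λ, where `Q̃′ = Q′`, take
the rows of `Q′₁` to be unit rows); (b) `μ` is an abstract ℝ-linear map with the (3.169) rule as hypothesis `hμ`
(its derivation from unique solvability is `mu_Dbar_of_unique`; the concrete averaging/axial-gauge `μ(B)` is g12's
`B9Eq3169Mu`, not imported); (c) `C′^{(k)}(Λ)`, `𝒢`, `𝒢̃` enter only through (3.172)/(3.175)/`R̃ = Δ𝒢̃Δ`; (d) real scalar
entries and arbitrary finite index types (𝔤-valued fields = an extra finite index; every identity is ℝ-linear);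
(e) `H′*` = `Hpᵀ` (real transpose).
RECORDS: GAPS C-B9-71 (certification-with-locator of (3.176)–(3.182), (3.184) ⇒ (3.183) algebra; misprint (3.182));
DIVERGENCE D-b09.50.  No `sorry`, no new axioms. -/

namespace Literature.MathematicalPhysics.QuantumFieldTheory.Balaban1983to89.B9Eq3184

open Matrix

variable {n b m b₁ m₁ : Type*}

/-! ## §1  (3.176) and (3.177) -/

/-- **(3.176)** `G̃′R̃ = G′R + H′C′^{(k)}(Λ)H′*Δ`, from (3.172) for both sequences (`G′R = 𝒢Δ`, `G̃′R̃ = 𝒢̃Δ`) and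
(3.175) (`𝒢̃ = 𝒢 + H′C′H′*`). [cite: Balaban1985BackgroundPropagators, (3.176) p.431] -/
theorem eq_3176 [Fintype n] [Fintype m] (Δ Gp Rp cG Gw Rw cGw : Matrix n n ℝ) (Hp : Matrix n m ℝ)
    (Cp : Matrix m m ℝ) (h172 : Gp * Rp = cG * Δ) (h172w : Gw * Rw = cGw * Δ)
    (h175 : cGw = cG + Hp * Cp * Hpᵀ) : Gw * Rw = Gp * Rp + Hp * Cp * Hpᵀ * Δ := by
  rw [h172w, h175, h172, Matrix.add_mul]

/-- **(3.177)** `ΔH′μ = G′Q′*(Q′G′²Q′*)⁻¹(μ − aQ′G′Q′*μ)` for the operator `H′` of (3.163) ([adv1's] `B9H163.H163`), BY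
NAME from `B9H163.Δ_mul_H163`. [cite: Balaban1985BackgroundPropagators, (3.177) p.431; (3.163) p.429] -/
theorem eq_3177 [Fintype n] [Fintype m] [DecidableEq n] [DecidableEq m] (Δ : Matrix n n ℝ) (Qp : Matrix m n ℝ)
    (a : ℝ) (hΔ' : IsUnit (B9H163.Δ' Δ Qp a)) (hM' : IsUnit (B9H163.M' Δ Qp a)) (μ : m → ℝ) :
    Δ *ᵥ (B9H163.H163 Δ Qp a *ᵥ μ) =
      B9H163.G' Δ Qp a *ᵥ (Qpᵀ *ᵥ ((B9H163.M' Δ Qp a)⁻¹ *ᵥ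
        (μ - a • (Qp *ᵥ (B9H163.G' Δ Qp a *ᵥ (Qpᵀ *ᵥ μ)))))) := by
  rw [Matrix.mulVec_mulVec, B9H163.Δ_mul_H163 hΔ' hM']
  simp only [← Matrix.mulVec_mulVec, Matrix.sub_mulVec, Matrix.one_mulVec, Matrix.smul_mulVec]

/-! ## §2  (3.178): the Landau surface -/

/-- (3.178) before applying `D`: on the Landau surface `R̃x = 0` (`x = D*A`), (3.176) applied to `x` gives
`G′Rx = −H′C′H′*Δx`. [cite: Balaban1985BackgroundPropagators, (3.178) p.431] -/
theorem eq_3178_vec [Fintype n] [Fintype m] (Δ Gp Rp Gw Rw : Matrix n n ℝ) (Hp : Matrix n m ℝ)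
    (Cp : Matrix m m ℝ) (h176 : Gw * Rw = Gp * Rp + Hp * Cp * Hpᵀ * Δ) (x : n → ℝ) (hL : Rw *ᵥ x = 0) :
    Gp *ᵥ (Rp *ᵥ x) = -(Hp *ᵥ (Cp *ᵥ (Hpᵀ *ᵥ (Δ *ᵥ x)))) := by
  have key : (Gw * Rw) *ᵥ x = 0 := by rw [← Matrix.mulVec_mulVec, hL, Matrix.mulVec_zero]
  rw [h176, Matrix.add_mulVec] at key
  simp only [← Matrix.mulVec_mulVec] at key
  exact eq_neg_of_add_eq_zero_left key

/-- **(3.178)** `DG′RD*A = −DH′C′^{(k)}(Λ)H′*ΔD*A` on the Landau surface `R̃D*A = 0`.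
[cite: Balaban1985BackgroundPropagators, (3.178) p.431] -/
theorem eq_3178 [Fintype n] [Fintype b] [Fintype m] (D : Matrix b n ℝ) (Δ Gp Rp Gw Rw : Matrix n n ℝ)
    (Hp : Matrix n m ℝ) (Cp : Matrix m m ℝ) (h176 : Gw * Rw = Gp * Rp + Hp * Cp * Hpᵀ * Δ) (A : b → ℝ)
    (hL : Rw *ᵥ (Dᵀ *ᵥ A) = 0) :
    D *ᵥ (Gp *ᵥ (Rp *ᵥ (Dᵀ *ᵥ A))) = -(D *ᵥ (Hp *ᵥ (Cp *ᵥ (Hpᵀ *ᵥ (Δ *ᵥ (Dᵀ *ᵥ A)))))) := by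
  rw [eq_3178_vec Δ Gp Rp Gw Rw Hp Cp h176 (Dᵀ *ᵥ A) hL, Matrix.mulVec_neg]

/-- The configuration inside the quadratic form of (3.170): `A − DG′RD*A + DH′μ(QA)`.
[cite: Balaban1985BackgroundPropagators, (3.170) p.430] -/
def cfg170 [Fintype n] [Fintype b] [Fintype m] (D : Matrix b n ℝ) (Gp Rp : Matrix n n ℝ) (Q : Matrix b₁ b ℝ)
    (Hp : Matrix n m ℝ) (μ : (b₁ → ℝ) →ₗ[ℝ] (m → ℝ)) (A : b → ℝ) : b → ℝ :=
  A - D *ᵥ (Gp *ᵥ (Rp *ᵥ (Dᵀ *ᵥ A))) + D *ᵥ (Hp *ᵥ μ (Q *ᵥ A))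

/-- The same configuration after (3.178): `A + DH′C′^{(k)}(Λ)H′*ΔD*A + DH′μ(QA)` — the *"remaining expressions"* in
which `A` is then replaced. [cite: Balaban1985BackgroundPropagators, (3.178) p.431] -/
def cfg178 [Fintype n] [Fintype b] [Fintype m] (D : Matrix b n ℝ) (Δ : Matrix n n ℝ) (Q : Matrix b₁ b ℝ)
    (Hp : Matrix n m ℝ) (Cp : Matrix m m ℝ) (μ : (b₁ → ℝ) →ₗ[ℝ] (m → ℝ)) (A : b → ℝ) : b → ℝ :=
  A + D *ᵥ (Hp *ᵥ (Cp *ᵥ (Hpᵀ *ᵥ (Δ *ᵥ (Dᵀ *ᵥ A))))) + D *ᵥ (Hp *ᵥ μ (Q *ᵥ A))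

/-- On the Landau surface the two configurations agree (this is how (3.178) is *used*).
[cite: Balaban1985BackgroundPropagators, (3.178) p.431] -/
theorem cfg170_eq_cfg178 [Fintype n] [Fintype b] [Fintype m] (D : Matrix b n ℝ) (Δ Gp Rp Gw Rw : Matrix n n ℝ)
    (Q : Matrix b₁ b ℝ) (Hp : Matrix n m ℝ) (Cp : Matrix m m ℝ) (μ : (b₁ → ℝ) →ₗ[ℝ] (m → ℝ))
    (h176 : Gw * Rw = Gp * Rp + Hp * Cp * Hpᵀ * Δ) (A : b → ℝ) (hL : Rw *ᵥ (Dᵀ *ᵥ A) = 0) :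
    cfg170 D Gp Rp Q Hp μ A = cfg178 D Δ Q Hp Cp μ A := by
  unfold cfg170 cfg178
  rw [eq_3178 D Δ Gp Rp Gw Rw Hp Cp h176 A hL, sub_neg_eq_add]

/-! ## §3  (3.179) -/

/-- `D*(A − Dy) = D*A − Δy` (`D*D = Δ`, (3.23)). [folklore] -/
theorem Dt_mulVec_sub [Fintype n] [Fintype b] (D : Matrix b n ℝ) (Δ : Matrix n n ℝ) (hΔ : Dᵀ * D = Δ)
    (A : b → ℝ) (y : n → ℝ) : Dᵀ *ᵥ (A - D *ᵥ y) = Dᵀ *ᵥ A - Δ *ᵥ y := by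
  rw [Matrix.mulVec_sub, Matrix.mulVec_mulVec, hΔ]

/-- **(3.179)**, the three printed links: with `x = D*A` and `A′ = A − DG̃′R̃D*A`,
`ΔD*A′ = Δx − Δ²𝒢̃Δx = Δx − ΔR̃x = ΔP̃x` (`D*D = Δ`, `G̃′R̃ = 𝒢̃Δ`, `Δ𝒢̃Δ = R̃`, `P̃ = 1 − R̃`); apply `H′*` (= `Hpᵀ *ᵥ`)
for the printed line. [cite: Balaban1985BackgroundPropagators, (3.179) p.431] -/
theorem eq_3179 [Fintype n] [Fintype b] [DecidableEq n] (D : Matrix b n ℝ) (Δ Gw Rw cGw : Matrix n n ℝ)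
    (hΔ : Dᵀ * D = Δ) (h172w : Gw * Rw = cGw * Δ) (hRw : Δ * cGw * Δ = Rw) (A : b → ℝ) :
    Δ *ᵥ (Dᵀ *ᵥ (A - D *ᵥ (Gw *ᵥ (Rw *ᵥ (Dᵀ *ᵥ A))))) =
        Δ *ᵥ (Dᵀ *ᵥ A) - Δ *ᵥ (Δ *ᵥ (cGw *ᵥ (Δ *ᵥ (Dᵀ *ᵥ A)))) ∧
      Δ *ᵥ (Dᵀ *ᵥ A) - Δ *ᵥ (Δ *ᵥ (cGw *ᵥ (Δ *ᵥ (Dᵀ *ᵥ A)))) = Δ *ᵥ (Dᵀ *ᵥ A) - Δ *ᵥ (Rw *ᵥ (Dᵀ *ᵥ A)) ∧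
      Δ *ᵥ (Dᵀ *ᵥ A) - Δ *ᵥ (Rw *ᵥ (Dᵀ *ᵥ A)) = Δ *ᵥ ((1 - Rw) *ᵥ (Dᵀ *ᵥ A)) := by
  refine ⟨?_, ?_, ?_⟩
  · rw [Dt_mulVec_sub D Δ hΔ, Matrix.mulVec_sub, Matrix.mulVec_mulVec (Dᵀ *ᵥ A) Gw Rw, h172w,
      ← Matrix.mulVec_mulVec]
  · rw [← hRw]
    simp only [← Matrix.mulVec_mulVec]
  · rw [Matrix.sub_mulVec, Matrix.one_mulVec, Matrix.mulVec_sub]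

/-- (3.179) end to end: `ΔD*(A − DG̃′R̃D*A) = ΔP̃D*A`. [cite: Balaban1985BackgroundPropagators, (3.179) p.431] -/
theorem eq_3179' [Fintype n] [Fintype b] [DecidableEq n] (D : Matrix b n ℝ) (Δ Gw Rw cGw : Matrix n n ℝ)
    (hΔ : Dᵀ * D = Δ) (h172w : Gw * Rw = cGw * Δ) (hRw : Δ * cGw * Δ = Rw) (A : b → ℝ) :
    Δ *ᵥ (Dᵀ *ᵥ (A - D *ᵥ (Gw *ᵥ (Rw *ᵥ (Dᵀ *ᵥ A))))) = Δ *ᵥ ((1 - Rw) *ᵥ (Dᵀ *ᵥ A)) := by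
  obtain ⟨h1, h2, h3⟩ := eq_3179 D Δ Gw Rw cGw hΔ h172w hRw A
  rw [h1, h2, h3]

/-! ## §4  The (3.169) rule `μ(D̄v) = −v` and (3.180)–(3.182) -/

/-- *"μ(D̄v) = −v if Q′₁v = 0, as it follows from the formula (3.169)"*: if the constraints of (3.168),
`Q′₁μ = 0` and `χ(B + D̄μ) = 0` (χ = restriction to the axial bonds), have for every `B` the unique solution `mu B`,
then `mu (D̄v) = −v` whenever `Q′₁v = 0` — because `−v` solves them at `B = D̄v`.
[cite: Balaban1985BackgroundPropagators, p.431 L-8; (3.169) p.430] -/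
theorem mu_Dbar_of_unique [Fintype m] [Fintype b₁] {ax : Type*} (Qp1 : Matrix m₁ m ℝ) (Db : Matrix b₁ m ℝ)
    (χ : Matrix ax b₁ ℝ) (mu : (b₁ → ℝ) → (m → ℝ))
    (hsol : ∀ B, Qp1 *ᵥ mu B = 0 ∧ χ *ᵥ (B + Db *ᵥ mu B) = 0)
    (huniq : ∀ B (ν₁ ν₂ : m → ℝ), Qp1 *ᵥ ν₁ = 0 → χ *ᵥ (B + Db *ᵥ ν₁) = 0 →
      Qp1 *ᵥ ν₂ = 0 → χ *ᵥ (B + Db *ᵥ ν₂) = 0 → ν₁ = ν₂)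
    (v : m → ℝ) (hv : Qp1 *ᵥ v = 0) : mu (Db *ᵥ v) = -v :=
  huniq (Db *ᵥ v) _ _ (hsol _).1 (hsol _).2 (by rw [Matrix.mulVec_neg, hv, neg_zero])
    (by rw [Matrix.mulVec_neg, add_neg_cancel, Matrix.mulVec_zero])

/-- `QDy = D̄Q′y` ((3.115): averaging intertwines the derivatives). [cite: Balaban1985BackgroundPropagators, (3.115) p.418] -/
theorem Q_mulVec_D [Fintype n] [Fintype b] [Fintype m] (Q : Matrix b₁ b ℝ) (D : Matrix b n ℝ)
    (Db : Matrix b₁ m ℝ) (Qp : Matrix m n ℝ) (h115 : Q * D = Db * Qp) (y : n → ℝ) :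
    Q *ᵥ (D *ᵥ y) = Db *ᵥ (Qp *ᵥ y) := by
  rw [Matrix.mulVec_mulVec, Matrix.mulVec_mulVec, h115]

/-- **(3.180)** `μ(Q(A − Dy)) = μ(QA) − μ(D̄Q′y)` (linearity of `μ` and `QD = D̄Q′`).
[cite: Balaban1985BackgroundPropagators, (3.180) p.431] -/
theorem eq_3180 [Fintype n] [Fintype b] [Fintype m] (Q : Matrix b₁ b ℝ) (D : Matrix b n ℝ)
    (Db : Matrix b₁ m ℝ) (Qp : Matrix m n ℝ) (h115 : Q * D = Db * Qp) (μ : (b₁ → ℝ) →ₗ[ℝ] (m → ℝ))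
    (A : b → ℝ) (y : n → ℝ) : μ (Q *ᵥ (A - D *ᵥ y)) = μ (Q *ᵥ A) - μ (Db *ᵥ (Qp *ᵥ y)) := by
  rw [Matrix.mulVec_sub, map_sub, Q_mulVec_D Q D Db Qp h115]

/-- **(3.181)** `μ(Q(A − DG̃′R̃D*A)) = μ(QA) + Q′G̃′R̃D*A`, from (3.180), the rule `μ(D̄v) = −v (Q′₁v = 0)` and
`Q′₁Q′G̃′R̃ = 0` (`hv`; = `wavy_kills` for the paper's wavy data). [cite: Balaban1985BackgroundPropagators, (3.181) p.431] -/
theorem eq_3181 [Fintype n] [Fintype b] [Fintype m] (Q : Matrix b₁ b ℝ) (D : Matrix b n ℝ)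
    (Db : Matrix b₁ m ℝ) (Qp : Matrix m n ℝ) (Qp1 : Matrix m₁ m ℝ) (Gw Rw : Matrix n n ℝ)
    (h115 : Q * D = Db * Qp) (hv : Qp1 * Qp * Gw * Rw = 0) (μ : (b₁ → ℝ) →ₗ[ℝ] (m → ℝ))
    (hμ : ∀ v : m → ℝ, Qp1 *ᵥ v = 0 → μ (Db *ᵥ v) = -v) (A : b → ℝ) :
    μ (Q *ᵥ (A - D *ᵥ (Gw *ᵥ (Rw *ᵥ (Dᵀ *ᵥ A))))) = μ (Q *ᵥ A) + Qp *ᵥ (Gw *ᵥ (Rw *ᵥ (Dᵀ *ᵥ A))) := by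
  have h0 : Qp1 *ᵥ (Qp *ᵥ (Gw *ᵥ (Rw *ᵥ (Dᵀ *ᵥ A)))) = 0 := by
    simp only [Matrix.mulVec_mulVec, ← Matrix.mul_assoc, hv, Matrix.zero_mul, Matrix.zero_mulVec]
  rw [eq_3180 Q D Db Qp h115 μ A, hμ _ h0, sub_neg_eq_add]

/-- **(3.182), corrected sign**: `Q(A − Dλ) + D̄μ(Q(A − Dλ)) = QA + D̄μ(QA)` if `Q̃′λ = 0` (`Q′₁Q′λ = 0`).  The printed
right-hand side reads `QA − D̄μ(QA)`; the `+` is what (3.183) uses (see `eq_3182_printed_fails`).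
[cite: Balaban1985BackgroundPropagators, (3.182) p.431] -/
theorem eq_3182 [Fintype n] [Fintype b] [Fintype m] (Q : Matrix b₁ b ℝ) (D : Matrix b n ℝ)
    (Db : Matrix b₁ m ℝ) (Qp : Matrix m n ℝ) (Qp1 : Matrix m₁ m ℝ) (h115 : Q * D = Db * Qp)
    (μ : (b₁ → ℝ) →ₗ[ℝ] (m → ℝ)) (hμ : ∀ v : m → ℝ, Qp1 *ᵥ v = 0 → μ (Db *ᵥ v) = -v) (A : b → ℝ)
    (lam : n → ℝ) (hlam : Qp1 *ᵥ (Qp *ᵥ lam) = 0) :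
    Q *ᵥ (A - D *ᵥ lam) + Db *ᵥ μ (Q *ᵥ (A - D *ᵥ lam)) = Q *ᵥ A + Db *ᵥ μ (Q *ᵥ A) := by
  rw [eq_3180 Q D Db Qp h115 μ A lam, hμ _ hlam, Matrix.mulVec_sub, Q_mulVec_D Q D Db Qp h115, sub_neg_eq_add,
    Matrix.mulVec_add]
  abel

/-- The PRINTED sign of (3.182) is wrong: with all operators `1 × 1`, `Q = D = D̄ = Q′ = 1`, `Q′₁ = 0`, `μ = −id`
(which obeys the rule), `A = 1`, `λ = 0` (so `Q̃′λ = 0`), the left side of (3.182) is `0` while the printed right side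
`QA − D̄μ(QA)` is `2`. [cite: Balaban1985BackgroundPropagators, (3.182) p.431] -/
theorem eq_3182_printed_fails :
    ∃ (Q D Db Qp Qp1 : Matrix Unit Unit ℝ) (μ : (Unit → ℝ) →ₗ[ℝ] (Unit → ℝ)) (A lam : Unit → ℝ),
      Q * D = Db * Qp ∧ (∀ v : Unit → ℝ, Qp1 *ᵥ v = 0 → μ (Db *ᵥ v) = -v) ∧ Qp1 *ᵥ (Qp *ᵥ lam) = 0 ∧
      Q *ᵥ (A - D *ᵥ lam) + Db *ᵥ μ (Q *ᵥ (A - D *ᵥ lam)) ≠ Q *ᵥ A - Db *ᵥ μ (Q *ᵥ A) := by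
  refine ⟨1, 1, 1, 1, 0, -LinearMap.id, fun _ => 1, 0, by simp, fun v _ => by simp, by simp, ?_⟩
  intro h
  have h1 := congr_fun h ()
  simp only [Matrix.mulVec_zero, sub_zero, Matrix.one_mulVec, LinearMap.neg_apply, LinearMap.id_apply,
    Pi.add_apply, Pi.neg_apply, Pi.sub_apply] at h1
  norm_num at h1

/-! ## §5  (3.184) and the expressions of (3.183) -/

/-- **λ̃(A)** of (3.184): `H′C′^{(k)}(Λ)H′*ΔP̃D*A + H′μ(QA) + H′Q′G̃′R̃D*A` (`P̃ = 1 − R̃`).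
[cite: Balaban1985BackgroundPropagators, (3.184) p.432] -/
def lamT [Fintype n] [Fintype b] [Fintype m] [DecidableEq n] (D : Matrix b n ℝ) (Δ Gw Rw : Matrix n n ℝ)
    (Q : Matrix b₁ b ℝ) (Qp : Matrix m n ℝ) (Hp : Matrix n m ℝ) (Cp : Matrix m m ℝ)
    (μ : (b₁ → ℝ) →ₗ[ℝ] (m → ℝ)) (A : b → ℝ) : n → ℝ :=
  Hp *ᵥ (Cp *ᵥ (Hpᵀ *ᵥ (Δ *ᵥ ((1 - Rw) *ᵥ (Dᵀ *ᵥ A))))) + Hp *ᵥ μ (Q *ᵥ A) +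
    Hp *ᵥ (Qp *ᵥ (Gw *ᵥ (Rw *ᵥ (Dᵀ *ᵥ A))))

/-- `A′ = A − DG̃′R̃D*A`, the replacement of p. 431. [cite: Balaban1985BackgroundPropagators, p.431 L17-18] -/
def aPrime [Fintype n] [Fintype b] (D : Matrix b n ℝ) (Gw Rw : Matrix n n ℝ) (A : b → ℝ) : b → ℝ :=
  A - D *ᵥ (Gw *ᵥ (Rw *ᵥ (Dᵀ *ᵥ A)))

/-- **The configuration of (3.183)**: replacing `A` by `A′ = A − DG̃′R̃D*A` in `A + DH′C′H′*ΔD*A + DH′μ(QA)` gives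
exactly `A − DG̃′R̃D*A + Dλ̃(A)` with `λ̃` of (3.184) — by (3.179) and (3.181).
[cite: Balaban1985BackgroundPropagators, (3.183)-(3.184) p.432] -/
theorem config_3183 [Fintype n] [Fintype b] [Fintype m] [DecidableEq n] (D : Matrix b n ℝ)
    (Δ Gw Rw cGw : Matrix n n ℝ) (Q : Matrix b₁ b ℝ) (Db : Matrix b₁ m ℝ) (Qp : Matrix m n ℝ)
    (Qp1 : Matrix m₁ m ℝ) (Hp : Matrix n m ℝ) (Cp : Matrix m m ℝ) (μ : (b₁ → ℝ) →ₗ[ℝ] (m → ℝ))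
    (hΔ : Dᵀ * D = Δ) (h172w : Gw * Rw = cGw * Δ) (hRw : Δ * cGw * Δ = Rw) (h115 : Q * D = Db * Qp)
    (hv : Qp1 * Qp * Gw * Rw = 0) (hμ : ∀ v : m → ℝ, Qp1 *ᵥ v = 0 → μ (Db *ᵥ v) = -v) (A : b → ℝ) :
    cfg178 D Δ Q Hp Cp μ (aPrime D Gw Rw A) = aPrime D Gw Rw A + D *ᵥ lamT D Δ Gw Rw Q Qp Hp Cp μ A := by
  unfold cfg178 aPrime lamT
  rw [eq_3179' D Δ Gw Rw cGw hΔ h172w hRw A, eq_3181 Q D Db Qp Qp1 Gw Rw h115 hv μ hμ A]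
  simp only [Matrix.mulVec_add]
  abel

/-- **The source field of (3.183)** is unchanged by the replacement: `QA′ + D̄μ(QA′) = QA + D̄μ(QA)` — (3.182) with
`λ = G̃′R̃D*A`, `Q̃′λ = 0`. [cite: Balaban1985BackgroundPropagators, (3.183) p.432] -/
theorem source_3183 [Fintype n] [Fintype b] [Fintype m] (D : Matrix b n ℝ) (Gw Rw : Matrix n n ℝ)
    (Q : Matrix b₁ b ℝ) (Db : Matrix b₁ m ℝ) (Qp : Matrix m n ℝ) (Qp1 : Matrix m₁ m ℝ)
    (μ : (b₁ → ℝ) →ₗ[ℝ] (m → ℝ)) (h115 : Q * D = Db * Qp) (hv : Qp1 * Qp * Gw * Rw = 0)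
    (hμ : ∀ v : m → ℝ, Qp1 *ᵥ v = 0 → μ (Db *ᵥ v) = -v) (A : b → ℝ) :
    Q *ᵥ aPrime D Gw Rw A + Db *ᵥ μ (Q *ᵥ aPrime D Gw Rw A) = Q *ᵥ A + Db *ᵥ μ (Q *ᵥ A) := by
  have h0 : Qp1 *ᵥ (Qp *ᵥ (Gw *ᵥ (Rw *ᵥ (Dᵀ *ᵥ A)))) = 0 := by
    simp only [Matrix.mulVec_mulVec, ← Matrix.mul_assoc, hv, Matrix.zero_mul, Matrix.zero_mulVec]
  unfold aPrime
  exact eq_3182 Q D Db Qp Qp1 h115 μ hμ A _ h0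

/-! ## §6  Edges to (3.25): the wavy operators kill the needed vector -/

/-- **`Q′G′R = 0`**, a consequence of (3.25) `R = I − G′Q′*(Q′G′²Q′*)⁻¹Q′G′`, for [adv1's] `B9H163.G'`, `B9H163.R`
(any data `(Δ, Q′, a)` with `Q′G′²Q′*` invertible). [cite: Balaban1985BackgroundPropagators, (3.25) p.394] -/
theorem Q_mul_G'_mul_R [Fintype n] [Fintype m] [DecidableEq n] [DecidableEq m] (Δ : Matrix n n ℝ)
    (Qt : Matrix m n ℝ) (a : ℝ) (hM' : IsUnit (B9H163.M' Δ Qt a)) :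
    Qt * (B9H163.G' Δ Qt a * B9H163.R Δ Qt a) = 0 := by
  unfold B9H163.R
  rw [Matrix.mul_sub, Matrix.mul_one, Matrix.mul_sub, sub_eq_zero]
  simp only [Matrix.mul_assoc]
  rw [B9H163.QG'G'Qt_Minv_mul hM']

/-- The hypothesis `hv` of `eq_3181`/`config_3183`/`source_3183` for the paper's wavy data: with `Q̃′ = Q′₁Q′`,
`G̃′ = G′(Δ, Q̃′, a)`, `R̃ = R(Δ, Q̃′, a)` one has `Q′₁Q′G̃′R̃ = Q̃′G̃′R̃ = 0`.
[cite: Balaban1985BackgroundPropagators, (3.25) p.394; p.431 L-7] -/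
theorem wavy_kills [Fintype n] [Fintype m] [Fintype m₁] [DecidableEq n] [DecidableEq m₁] (Δ : Matrix n n ℝ)
    (Qp : Matrix m n ℝ) (Qp1 : Matrix m₁ m ℝ) (a : ℝ) (hM' : IsUnit (B9H163.M' Δ (Qp1 * Qp) a)) :
    Qp1 * Qp * B9H163.G' Δ (Qp1 * Qp) a * B9H163.R Δ (Qp1 * Qp) a = 0 := by
  rw [Matrix.mul_assoc]
  exact Q_mul_G'_mul_R Δ (Qp1 * Qp) a hM'

end Literature.MathematicalPhysics.QuantumFieldTheory.Balaban1983to89.B9Eq3184
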